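import Literature.MathematicalPhysics.QuantumLattice.HubbardGridSectorisedYoung
import Literature.MathematicalPhysics.QuantumLattice.SectorisedKernelNormExtraction
import HarnessLib

/-!
# The sector transfer functions of the time-grid substitution are translates of ONE space–time profile per (sector, charge):
# reduction of the two sizes `B`, `D` of the cross-grid Young inequality to a single grid `ℓ¹` norm

Topic `MathematicalPhysics/QuantumLattice`; continuation of `HubbardGridSectorisedYoung` (the cross-grid Young inequality
`‖map S F‖_{sect} ≤ B^m · D · K`, with `B`, `D` the label-summed weighted `L¹` size, resp. the grid size, of the sector transfer
functions `gridLegTransfer β Fam ℓ x Y`).  For the grid `N = 2·(2M)` of the scale-`0` step (which contains the dual time lattice of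
`SpaceTimeIdx L M`) the transfer function of the leg label `ℓ = ((ω,σ),c)` is the indicator `[σ, c match those of Y]` times the
translate, to the space–time difference `(x₀ − τ_Y, x⃗ − y⃗)`, of ONE profile

  `prof_{ω,c}(t, z⃗) = (βL²)⁻¹ Σ_{k=(n,k⃗)} F_ω(k) e^{-i s_c ω_n t} χ_{k⃗}(z⃗)^{∓}`

(`gridLegTransfer_eq_profile`), whose modulus is `β`-periodic in `t` (`norm_gridTransferProfile_add_int_mul`).  Consequently BOTH sizes
are controlled by the single grid `ℓ¹` quantity `A ≥ Σ_{d ∈ [-N, N)} Σ_{z⃗} |prof_{ω,c}(dβ/N, z⃗)|` (two periods of the `N`-point time grid ×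
the torus): `Σ_x |Φ_ℓ(x;Y)| ≤ A` (`sum_norm_gridLegTransfer_le_profile`, the dual-lattice times embed as the even grid times) and
`Σ_Y |Φ_ℓ(x;Y)| ≤ A` (`sum_norm_gridLegTransfer_le_profile'`), whence the Young inequality in the form the scale-`0` engine step consumes:
**`hubbardSectorKernelNorm_map_hubbardGridSub_le_of_profile`**: `‖map S F‖_{sect, m+1} ≤ (ε_x·|labels|·A)^m · A · K`.
The remaining analytic input is the grid `ℓ¹` norm `A` of the profile of a concrete multiplier family — a space–time character sum of
the type priced by `MatsubaraGridWeightedPlancherel.sum_norm_gridKernel_le`.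

Everything is proved; the one definition is the profile; no named facts.

## Sources

G. Benfatto, A. Giuliani, V. Mastropietro, Ann. Henri Poincaré 7 (2006) 809–898, §2.5 (2.48), §2.7 (2.70)–(2.71), §2.8 (2.82) (the
sector functions `F̃_{h,ω}` and their position-space `L¹` norms) [`BenfattoGiulianiMastropietro2006`]; M. Salmhofer, *Renormalization*
(1999), §4.2.4 (4.55)–(4.58) [`Salmhofer1999`].
-/

noncomputable section

namespace Literature.MathematicalPhysics.QuantumLattice

open GrassmannAlgebra Finset Literature.Probability.LatticeModels
open scoped ComplexConjugate

section Profile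

variable (L M : ℕ) [NeZero L]

/-- **The space–time profile of the sector `ω` read with charge `c`**:
`prof_{ω,c}(t, z⃗) = (βL²)⁻¹ Σ_{k=(n,k⃗)} F_ω(k) · e^{-i s_c ω_n t} · χ_{k⃗}(z⃗)^{∓}` (`conj χ` for `ψ⁺`, `χ` for `ψ⁻`) — the lattice
Fourier transform of the sector multiplier at time `t ∈ ℝ` and lattice vector `z⃗`. [cite: BenfattoGiulianiMastropietro2006, §2.5 (2.48)] -/
def gridTransferProfile {Ns : ℕ} (β : ℝ) (Fam : Fin Ns → FreqMomentum L M → ℂ) (ω : Fin Ns) (c : Fin 2) (t : ℝ)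
    (z : TorusSite 2 L) : ℂ :=
  (((1 / (β * (L : ℝ) ^ 2) : ℝ)) : ℂ) * ∑ k : FreqMomentum L M, Fam ω k *
    (Complex.exp (-((chargeSign c * (matsubaraFreq β M k.1 * t) : ℝ) : ℂ) * Complex.I) *
      (if c = 0 then conj (torusChar k.2 z) else torusChar k.2 z))

variable {L M}

/-- The leg phases of the transfer function combine to the profile's phase at the space–time difference:
`e^{-is_c k·x} · (βL²)⁻¹·conj(e^{-is_c k·(y⃗,τ)}) = (βL²)⁻¹ e^{-is_c ω (x₀−τ)} χ_{k⃗}(x⃗−y⃗)^{∓}`. [cite: BenfattoGiulianiMastropietro2006, §2.1 (2.5)] -/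
theorem hubbardPlaneWave_mul_conj_vertexPlaneWave (β : ℝ) (c : Fin 2) (k : FreqMomentum L M) (x : SpaceTimeIdx L M)
    (y : TorusSite 2 L) (τ : ℝ) :
    hubbardPlaneWave L M β c k x * conj (vertexPlaneWave L M β c k y τ) =
      Complex.exp (-((chargeSign c * (matsubaraFreq β M k.1 * (imagTime β M x.1 - τ)) : ℝ) : ℂ) * Complex.I) *
        (if c = 0 then conj (torusChar k.2 (x.2 - y)) else torusChar k.2 (x.2 - y)) := by
  rw [hubbardPlaneWave_eq]
  have h2 : ∀ c' : Fin 2, c' = 0 ∨ c' = 1 := by decide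
  rcases h2 c with hc | hc
  · subst hc
    rw [conj_vertexPlaneWave_zero_eq, if_pos rfl, if_pos rfl, torusChar_sub_right, map_mul, starRingEnd_self_apply]
    have hexp : Complex.exp (-((chargeSign 0 * (matsubaraFreq β M k.1 * imagTime β M x.1) : ℝ) : ℂ) * Complex.I) *
        Complex.exp (((matsubaraFreq β M k.1 * τ : ℝ) : ℂ) * Complex.I) =
        Complex.exp (-((chargeSign 0 * (matsubaraFreq β M k.1 * (imagTime β M x.1 - τ)) : ℝ) : ℂ) * Complex.I) := by
      rw [← Complex.exp_add]
      congr 1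
      simp only [chargeSign, if_true]
      push_cast
      ring
    rw [← hexp]
    ring
  · subst hc
    rw [conj_vertexPlaneWave_one_eq, if_neg (show (1 : Fin 2) ≠ 0 by decide), if_neg (show (1 : Fin 2) ≠ 0 by decide),
      torusChar_sub_right]
    have hexp : Complex.exp (-((chargeSign 1 * (matsubaraFreq β M k.1 * imagTime β M x.1) : ℝ) : ℂ) * Complex.I) *
        Complex.exp (-(((matsubaraFreq β M k.1 * τ : ℝ) : ℂ) * Complex.I)) =
        Complex.exp (-((chargeSign 1 * (matsubaraFreq β M k.1 * (imagTime β M x.1 - τ)) : ℝ) : ℂ) * Complex.I) := by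
      rw [← Complex.exp_add]
      congr 1
      simp only [chargeSign, if_neg (show (1 : Fin 2) ≠ 0 by decide)]
      push_cast
      ring
    rw [← hexp]
    ring

/-- **The transfer function is a translate of the profile**: for the leg label `ℓ = ((ω,σ),c)`, the dual-lattice point `x = (x₀, x⃗)`
and the grid leg `Y = (((τ, y⃗), σ'), c')`,
`Φ_ℓ(x; Y) = [σ = σ' ∧ c = c'] · prof_{ω,c}(x₀ − τ, x⃗ − y⃗)`. [cite: BenfattoGiulianiMastropietro2006, §2.7 (2.70)–(2.71)] -/
theorem gridLegTransfer_eq_profile {Ns N : ℕ} (β : ℝ) (Fam : Fin Ns → FreqMomentum L M → ℂ) (ℓ : SectorLeg Ns)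
    (x : SpaceTimeIdx L M) (Y : GridLeg (GridPoint L N)) :
    gridLegTransfer L M N β Fam ℓ x Y =
      if ℓ.1.2 = Y.1.2 ∧ ℓ.2 = Y.2 then
        gridTransferProfile L M β Fam ℓ.1.1 ℓ.2 (imagTime β M x.1 - gridTime β N Y.1.1.1) (x.2 - Y.1.1.2)
      else 0 := by
  rw [gridLegTransfer]
  simp only [hubbardGridSub, gridSubMatrix_apply]
  split_ifs with h
  · obtain ⟨_, hc⟩ := h
    rw [gridTransferProfile, mul_sum]
    refine sum_congr rfl fun k _ => ?_
    rw [← hc, show Fam ℓ.1.1 k * hubbardPlaneWave L M β ℓ.2 k x *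
        ((((1 / (β * (L : ℝ) ^ 2) : ℝ)) : ℂ) * conj (vertexPlaneWave L M β ℓ.2 k Y.1.1.2 (gridTime β N Y.1.1.1))) =
        (((1 / (β * (L : ℝ) ^ 2) : ℝ)) : ℂ) * (Fam ℓ.1.1 k *
          (hubbardPlaneWave L M β ℓ.2 k x * conj (vertexPlaneWave L M β ℓ.2 k Y.1.1.2 (gridTime β N Y.1.1.1)))) by ring,
      hubbardPlaneWave_mul_conj_vertexPlaneWave]
  · simp

/-- **The modulus of the profile is `β`-periodic in time**: `|prof(t + wβ)| = |prof(t)|` for every integer `w` (each Matsubara phase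
picks up `e^{-is_c π(2n+1)w} = (−1)^{w}`, the same for all `n`). [cite: BenfattoGiulianiMastropietro2006, §2.1 (2.5)] -/
theorem norm_gridTransferProfile_add_int_mul {Ns : ℕ} (β : ℝ) (Fam : Fin Ns → FreqMomentum L M → ℂ) (ω : Fin Ns) (c : Fin 2)
    (t : ℝ) (w : ℤ) (z : TorusSite 2 L) :
    ‖gridTransferProfile L M β Fam ω c (t + β * w) z‖ = ‖gridTransferProfile L M β Fam ω c t z‖ := by
  rcases eq_or_ne β 0 with hβ | hβ
  · subst hβ
    simp
  -- the common unimodular factor `u = e^{-iπ s_c w}`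
  set u : ℂ := Complex.exp (-((chargeSign c * Real.pi * w : ℝ) : ℂ) * Complex.I) with hu
  have hu1 : ‖u‖ = 1 := by
    rw [hu, ← Complex.ofReal_neg, Complex.norm_exp_ofReal_mul_I]
  have hphase : ∀ k : FreqMomentum L M,
      Complex.exp (-((chargeSign c * (matsubaraFreq β M k.1 * (t + β * w)) : ℝ) : ℂ) * Complex.I) =
        u * Complex.exp (-((chargeSign c * (matsubaraFreq β M k.1 * t) : ℝ) : ℂ) * Complex.I) := by
    intro k
    have hωβ : matsubaraFreq β M k.1 * β = Real.pi * (2 * (matsubaraInt M k.1 : ℝ) + 1) := by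
      simp only [matsubaraFreq]
      field_simp
    have hωβC : ((matsubaraFreq β M k.1 : ℝ) : ℂ) * (β : ℂ) = (Real.pi : ℂ) * (2 * ((matsubaraInt M k.1 : ℤ) : ℂ) + 1) := by
      exact_mod_cast hωβ
    have h2 : ∀ c' : Fin 2, c' = 0 ∨ c' = 1 := by decide
    rcases h2 c with hc | hc
    · have hs : chargeSign c = 1 := by simp [chargeSign, hc]
      have hone : Complex.exp (((-(matsubaraInt M k.1 * w) : ℤ) : ℂ) * (2 * Real.pi * Complex.I)) = 1 :=
        Complex.exp_int_mul_two_pi_mul_I _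
      have key : (-((chargeSign c * (matsubaraFreq β M k.1 * (t + β * w)) : ℝ) : ℂ) * Complex.I) =
          (-((chargeSign c * Real.pi * w : ℝ) : ℂ) * Complex.I) +
            ((-((chargeSign c * (matsubaraFreq β M k.1 * t) : ℝ) : ℂ) * Complex.I) +
              (((-(matsubaraInt M k.1 * w) : ℤ) : ℂ) * (2 * Real.pi * Complex.I))) := by
        rw [hs]
        push_cast
        linear_combination (-(w : ℂ) * Complex.I) * hωβC
      rw [key, Complex.exp_add, Complex.exp_add, hone, mul_one]
    · have hs : chargeSign c = -1 := by simp [chargeSign, hc]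
      have hone : Complex.exp (((matsubaraInt M k.1 * w : ℤ) : ℂ) * (2 * Real.pi * Complex.I)) = 1 :=
        Complex.exp_int_mul_two_pi_mul_I _
      have key : (-((chargeSign c * (matsubaraFreq β M k.1 * (t + β * w)) : ℝ) : ℂ) * Complex.I) =
          (-((chargeSign c * Real.pi * w : ℝ) : ℂ) * Complex.I) +
            ((-((chargeSign c * (matsubaraFreq β M k.1 * t) : ℝ) : ℂ) * Complex.I) +
              (((matsubaraInt M k.1 * w : ℤ) : ℂ) * (2 * Real.pi * Complex.I))) := by
        rw [hs]
        push_cast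
        linear_combination ((w : ℂ) * Complex.I) * hωβC
      rw [key, Complex.exp_add, Complex.exp_add, hone, mul_one]
  rw [gridTransferProfile, gridTransferProfile]
  simp_rw [hphase]
  rw [show (∑ k : FreqMomentum L M, Fam ω k * (u * Complex.exp (-((chargeSign c * (matsubaraFreq β M k.1 * t) : ℝ) : ℂ) * Complex.I) *
      (if c = 0 then conj (torusChar k.2 z) else torusChar k.2 z))) =
      u * ∑ k : FreqMomentum L M, Fam ω k * (Complex.exp (-((chargeSign c * (matsubaraFreq β M k.1 * t) : ℝ) : ℂ) * Complex.I) *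
        (if c = 0 then conj (torusChar k.2 z) else torusChar k.2 z)) by
    rw [mul_sum]; exact sum_congr rfl fun k _ => by ring]
  rw [← mul_assoc, mul_comm _ u, mul_assoc, norm_mul, hu1, one_mul]

end Profile

/-! ### The two sizes of the Young inequality from one grid `ℓ¹` norm of the profile (grid `N = 2·(2M)`) -/

section Sizes

variable {L M : ℕ} [NeZero L]

/-- The dual-lattice time `jβ/(2M)` minus the grid time `j'β/(4M)` is the grid time of the integer `2j − j'`. [cite: Salmhofer1999, §4.2.4 (4.55)] -/
theorem imagTime_sub_gridTime (β : ℝ) (j : ImagTimeIdx M) (j' : Fin (2 * (2 * M))) :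
    imagTime β M j - gridTime β (2 * (2 * M)) j' = ((2 * (j : ℤ) - (j' : ℤ) : ℤ) : ℝ) * β / ((2 * (2 * M) : ℕ) : ℝ) := by
  rcases Nat.eq_zero_or_pos M with hM | hM
  · subst hM
    simp [imagTime, gridTime]
  · have hMr : (M : ℝ) ≠ 0 := by exact_mod_cast hM.ne'
    simp only [imagTime, gridTime]
    push_cast
    field_simp

/-- The integers `2j − j'`, `j < 2M`, `j' < 4M`, lie in `[-4M, 4M)`. [folklore] -/
private theorem two_mul_sub_mem_Ico (j : ImagTimeIdx M) (j' : Fin (2 * (2 * M))) :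
    (2 * (j : ℤ) - (j' : ℤ)) ∈ Finset.Ico (-((2 * (2 * M) : ℕ) : ℤ)) ((2 * (2 * M) : ℕ) : ℤ) := by
  have hj := j.isLt
  have hj' := j'.isLt
  simp only [Finset.mem_Ico]
  push_cast
  omega

/-- **The dual-lattice `ℓ¹` size of a transfer function is at most the two-period grid `ℓ¹` norm of its profile**: for the grid
`N = 2·(2M)`, every leg label `ℓ = ((ω,σ),c)` and grid leg `Y`,
`Σ_{x ∈ dual lattice} |Φ_ℓ(x;Y)| ≤ Σ_{d ∈ [-N,N)} Σ_{z⃗} |prof_{ω,c}(dβ/N, z⃗)|` (the dual times are the even grid times; `j ↦ 2j − j_Y` is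
injective). [cite: BenfattoGiulianiMastropietro2006, §2.8 (2.82)] -/
theorem sum_norm_gridLegTransfer_le_profile {Ns : ℕ} (β : ℝ) (Fam : Fin Ns → FreqMomentum L M → ℂ) (ℓ : SectorLeg Ns)
    (Y : GridLeg (GridPoint L (2 * (2 * M)))) :
    ∑ x : SpaceTimeIdx L M, ‖gridLegTransfer L M (2 * (2 * M)) β Fam ℓ x Y‖ ≤
      ∑ d ∈ Finset.Ico (-((2 * (2 * M) : ℕ) : ℤ)) ((2 * (2 * M) : ℕ) : ℤ),
        ∑ z : TorusSite 2 L, ‖gridTransferProfile L M β Fam ℓ.1.1 ℓ.2 ((d : ℝ) * β / ((2 * (2 * M) : ℕ) : ℝ)) z‖ := by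
  set G : ℤ → ℝ := fun d => ∑ z : TorusSite 2 L, ‖gridTransferProfile L M β Fam ℓ.1.1 ℓ.2 ((d : ℝ) * β / ((2 * (2 * M) : ℕ) : ℝ)) z‖
    with hG
  have hG0 : ∀ d, 0 ≤ G d := fun d => sum_nonneg fun _ _ => norm_nonneg _
  simp_rw [gridLegTransfer_eq_profile]
  split_ifs with h
  · rw [Fintype.sum_prod_type]
    -- the spatial sum is a translate of `G`; the time index embeds injectively into `[-N, N)`
    have hx : ∀ j : ImagTimeIdx M, ∑ xs : TorusSite 2 L,
        ‖gridTransferProfile L M β Fam ℓ.1.1 ℓ.2 (imagTime β M j - gridTime β (2 * (2 * M)) Y.1.1.1) (xs - Y.1.1.2)‖ =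
        G (2 * (j : ℤ) - (Y.1.1.1 : ℤ)) := by
      intro j
      rw [hG, imagTime_sub_gridTime]
      exact Fintype.sum_equiv (Equiv.subRight Y.1.1.2) _ _ fun xs => by simp [Equiv.subRight]
    simp_rw [hx]
    have hinj : Set.InjOn (fun j : ImagTimeIdx M => 2 * (j : ℤ) - (Y.1.1.1 : ℤ)) (univ : Finset (ImagTimeIdx M)) := by
      intro a _ b _ hab
      have : (a : ℤ) = b := by
        have h' : 2 * (a : ℤ) - (Y.1.1.1 : ℤ) = 2 * (b : ℤ) - (Y.1.1.1 : ℤ) := hab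
        omega
      exact Fin.ext (by exact_mod_cast this)
    calc ∑ j : ImagTimeIdx M, G (2 * (j : ℤ) - (Y.1.1.1 : ℤ))
        = ∑ d ∈ (univ : Finset (ImagTimeIdx M)).image (fun j : ImagTimeIdx M => 2 * (j : ℤ) - (Y.1.1.1 : ℤ)), G d :=
          (sum_image hinj).symm
      _ ≤ ∑ d ∈ Finset.Ico (-((2 * (2 * M) : ℕ) : ℤ)) ((2 * (2 * M) : ℕ) : ℤ), G d := by
          refine sum_le_sum_of_subset_of_nonneg (fun d hd => ?_) fun d _ _ => hG0 d
          obtain ⟨j, _, rfl⟩ := mem_image.1 hd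
          exact two_mul_sub_mem_Ico j Y.1.1.1
  · simp only [norm_zero, sum_const_zero]
    exact sum_nonneg fun d _ => hG0 d

/-- **The grid `ℓ¹` size of a transfer function is at most the two-period grid `ℓ¹` norm of its profile**: for the grid `N = 2·(2M)`,
every leg label `ℓ` and dual-lattice point `x`, `Σ_{Y ∈ grid legs} |Φ_ℓ(x;Y)| ≤ Σ_{d ∈ [-N,N)} Σ_{z⃗} |prof_{ω,c}(dβ/N, z⃗)|` (only the legs
with the spin and charge of `ℓ` contribute; `j' ↦ 2j_x − j'` is injective). [cite: BenfattoGiulianiMastropietro2006, §2.8 (2.82)] -/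
theorem sum_norm_gridLegTransfer_le_profile' {Ns : ℕ} (β : ℝ) (Fam : Fin Ns → FreqMomentum L M → ℂ) (ℓ : SectorLeg Ns)
    (x : SpaceTimeIdx L M) :
    ∑ Y : GridLeg (GridPoint L (2 * (2 * M))), ‖gridLegTransfer L M (2 * (2 * M)) β Fam ℓ x Y‖ ≤
      ∑ d ∈ Finset.Ico (-((2 * (2 * M) : ℕ) : ℤ)) ((2 * (2 * M) : ℕ) : ℤ),
        ∑ z : TorusSite 2 L, ‖gridTransferProfile L M β Fam ℓ.1.1 ℓ.2 ((d : ℝ) * β / ((2 * (2 * M) : ℕ) : ℝ)) z‖ := by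
  set G : ℤ → ℝ := fun d => ∑ z : TorusSite 2 L, ‖gridTransferProfile L M β Fam ℓ.1.1 ℓ.2 ((d : ℝ) * β / ((2 * (2 * M) : ℕ) : ℝ)) z‖
    with hG
  have hG0 : ∀ d, 0 ≤ G d := fun d => sum_nonneg fun _ _ => norm_nonneg _
  simp_rw [gridLegTransfer_eq_profile]
  -- sum over `Y = (((j', y⃗), σ'), c')`: the indicator fixes `σ' = σ`, `c' = c`
  rw [Fintype.sum_prod_type, Fintype.sum_prod_type, Fintype.sum_prod_type]
  have hcollapse : ∀ (j' : Fin (2 * (2 * M))) (ys : TorusSite 2 L),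
      ∑ σ' : Fin 2, ∑ c' : Fin 2, ‖(if ℓ.1.2 = σ' ∧ ℓ.2 = c' then
        gridTransferProfile L M β Fam ℓ.1.1 ℓ.2 (imagTime β M x.1 - gridTime β (2 * (2 * M)) j') (x.2 - ys) else 0)‖ =
        ‖gridTransferProfile L M β Fam ℓ.1.1 ℓ.2 (imagTime β M x.1 - gridTime β (2 * (2 * M)) j') (x.2 - ys)‖ := by
    intro j' ys
    simp_rw [ite_and, apply_ite (f := fun t : ℂ => ‖t‖), norm_zero]
    rw [sum_comm]
    simp only [sum_ite_eq, mem_univ, if_true]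
  simp_rw [hcollapse]
  have hy : ∀ j' : Fin (2 * (2 * M)), ∑ ys : TorusSite 2 L,
      ‖gridTransferProfile L M β Fam ℓ.1.1 ℓ.2 (imagTime β M x.1 - gridTime β (2 * (2 * M)) j') (x.2 - ys)‖ =
      G (2 * (x.1 : ℤ) - (j' : ℤ)) := by
    intro j'
    rw [hG, imagTime_sub_gridTime]
    exact Fintype.sum_equiv (Equiv.subLeft x.2) _ _ fun ys => by simp [Equiv.subLeft]
  simp_rw [hy]
  have hinj : Set.InjOn (fun j' : Fin (2 * (2 * M)) => 2 * (x.1 : ℤ) - (j' : ℤ)) (univ : Finset (Fin (2 * (2 * M)))) := by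
    intro a _ b _ hab
    have : (a : ℤ) = b := by
      have h' : 2 * (x.1 : ℤ) - (a : ℤ) = 2 * (x.1 : ℤ) - (b : ℤ) := hab
      omega
    exact Fin.ext (by exact_mod_cast this)
  calc ∑ j' : Fin (2 * (2 * M)), G (2 * (x.1 : ℤ) - (j' : ℤ))
      = ∑ d ∈ (univ : Finset (Fin (2 * (2 * M)))).image (fun j' : Fin (2 * (2 * M)) => 2 * (x.1 : ℤ) - (j' : ℤ)), G d :=
        (sum_image hinj).symm
    _ ≤ ∑ d ∈ Finset.Ico (-((2 * (2 * M) : ℕ) : ℤ)) ((2 * (2 * M) : ℕ) : ℤ), G d := by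
        refine sum_le_sum_of_subset_of_nonneg (fun d hd => ?_) fun d _ _ => hG0 d
        obtain ⟨j', _, rfl⟩ := mem_image.1 hd
        exact two_mul_sub_mem_Ico x.1 j'

/-- **The cross-grid Young inequality from one grid `ℓ¹` norm of the profiles** (grid `N = 2·(2M)`): if
`Σ_{d ∈ [-N,N)} Σ_{z⃗} |prof_{ω,c}(dβ/N, z⃗)| ≤ A` for every sector `ω` and charge `c`, and the grid polynomial `F` has pinned degree-`(m+1)`
kernel norms `≤ K`, then `‖map S F‖_{sect, m+1} ≤ (ε_x·|labels|·A)^m · A · K` for every constraint set (`ε_x = β/(2M)`,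
`|labels| = 4·(number of sectors)`). [cite: BenfattoGiulianiMastropietro2006, §2.8 (2.82)] -/
theorem hubbardSectorKernelNorm_map_hubbardGridSub_le_of_profile {Ns m : ℕ} {β : ℝ} (hβ : 0 ≤ β)
    (Fam : Fin Ns → FreqMomentum L M → ℂ) (Aset : Finset (Fin (m + 1) → SectorLeg Ns))
    (F : GrassmannAlgebra ℂ (GridLeg (GridPoint L (2 * (2 * M))))) {A K : ℝ} (hA0 : 0 ≤ A) (hK0 : 0 ≤ K)
    (hA : ∀ (ω : Fin Ns) (c : Fin 2), ∑ d ∈ Finset.Ico (-((2 * (2 * M) : ℕ) : ℤ)) ((2 * (2 * M) : ℕ) : ℤ),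
      ∑ z : TorusSite 2 L, ‖gridTransferProfile L M β Fam ω c ((d : ℝ) * β / ((2 * (2 * M) : ℕ) : ℝ)) z‖ ≤ A)
    (hK : ∀ (p : Fin (m + 1)) (w : GridLeg (GridPoint L (2 * (2 * M)))),
      ∑ Y ∈ univ.filter (fun Y : Fin (m + 1) → GridLeg (GridPoint L (2 * (2 * M))) => Y p = w), ‖kernel ℂ F (m + 1) Y‖ ≤ K) :
    hubbardSectorKernelNorm L M β Fam Aset (ExteriorAlgebra.map (Matrix.toLin' (hubbardGridSub L M β (2 * (2 * M)))) F) ≤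
      (imagTimeWeight β M * Fintype.card (SectorLeg Ns) * A) ^ m * A * K := by
  have hε : 0 ≤ imagTimeWeight β M := imagTimeWeight_nonneg hβ M
  refine hubbardSectorKernelNorm_map_hubbardGridSub_le hβ Fam Aset F (by positivity) hA0 hK0 (fun Y => ?_) (fun ℓ x => ?_) hK
  · calc ∑ ℓ : SectorLeg Ns, imagTimeWeight β M * ∑ x : SpaceTimeIdx L M, ‖gridLegTransfer L M (2 * (2 * M)) β Fam ℓ x Y‖
        ≤ ∑ _ℓ : SectorLeg Ns, imagTimeWeight β M * A :=
          sum_le_sum fun ℓ _ => mul_le_mul_of_nonneg_left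
            ((sum_norm_gridLegTransfer_le_profile β Fam ℓ Y).trans (hA ℓ.1.1 ℓ.2)) hε
      _ = imagTimeWeight β M * Fintype.card (SectorLeg Ns) * A := by
          rw [sum_const, card_univ, nsmul_eq_mul]
          ring
  · exact (sum_norm_gridLegTransfer_le_profile' β Fam ℓ x).trans (hA ℓ.1.1 ℓ.2)

end Sizes

end Literature.MathematicalPhysics.QuantumLattice

end
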